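/-
Copyright (c) 2026 the pub-hodgecm-mathlib formalisation cell (harness21).  Prover seat hodgecm-mathlib-K2E3-p23 (g2): Track B «K2-LIT», engine E3, line (ii′)
«H-side central germ expansion» (line lead K2E4-p06 (g2)), leaf (E) `sig_K2E3CentralGermExpansionExistence`, brick (E2) «STRATA₂», matrix half; 2026-09-04.
-/
import Literature.NumberTheory.Automorphic.UnitaryTwoUnipotentClasses    -- ★ (F0P3a-p08 (g17)): `exists_conj_coe_eq_lineUnipotent`, `B₀_apply_conj_lineUnipotent_sub_one_mulVec`, `range_B₀_conj_lineUnipotent_sub_one_mulVec`, `exists_conj_lineUnipotent_eq_iff_exists_norm_mul`, `B₀_two_apply`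
import Mathlib.Topology.Algebra.Valued.ValuationTopology
import HarnessLib

/-!
# The regular unipotent classes `[n(t)]` of `U(σ, J₀) = U(Φ₂)` over a valued field are OPEN IN THEIR STRATUM whenever the `σ`-fixed units near `1` are norms
(Rogawski 1990 §1.10, §3.9; Serre, Local Fields V §2–§3) — the rank-one twin of ★ `UnitaryThreeTransvectionClassOpenOfNorm`

Topic `NumberTheory/Automorphic`; namespace `Literature.NumberTheory.Automorphic.UnitaryGroup`.  THEOREMS ONLY (no definition, no instance, no notation, no named fact,
no `sorry`); kernel lane `--supports stmt-HodgeConjecture-24833`.  Cell `pub/hodgecm-mathlib` (D-0151), crux H413 = `stmt-HodgeConjecture-24833`; Track B «K2-LIT», engine E3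
`K2_E3_EllipticInputs`, tier-1 unit `…Sigs_U3bCentralGerms` (ED. 3), line (ii′) «H-side central germ expansion» (line lead K2E4-p06 (g2)), leaf **(E)
`sig_K2E3CentralGermExpansionExistence`** (STABLE, CENTRED Shalika germ expansion on `H_v = U(Φ₂)_v × U(Φ₁)_v`), brick **(E2) «STRATA₂»**, MATRIX HALF (field level) —
K2E3-p23 (g2)'s programme (E1) ★ p855739 ‹U-FIN₂› · (E2) «STRATA₂» · (E3) ‹RAO₂› · (E4) ‹DUAL₂› · (E5) PLUG.  The CM carrier at a central `z` is served by the sequel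
`Rogawski1990/UnitaryTwoOneCentralUnipotentStrataCM`.
HONEST LABEL: HC_CM is proved only modulo the 7 printed citations (2 remaining named inputs: hLiu418 = stmt-HodgeConjecture-24832, h413 = stmt-HodgeConjecture-24833) until rung 0
closes; in-house linear algebra ∕ point-set topology over a valued field, count-neutral.

WHAT.  `K` a valued field, `σ` an involution of `K`, `J₀ = (StdForm.antidiagonal 2).over K = antidiag(1, 1)`, `U = U(σ, J₀) ≤ GL₂(K)` (★ `unitaryGroupOfForm`), `n(t) = (1, t; 0, 1)`.
The non-trivial unipotent elements of `U` (`(g − 1)² = 0`, `g ≠ 1`) are the conjugates of the `n(t)`, `σt = −t`, `t ≠ 0` (★ `exists_conj_coe_eq_lineUnipotent`), and `[n(t)] = [n(t′)]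
⟺ t′ ∈ t·N(K^×)` (★ `exists_conj_lineUnipotent_eq_iff_exists_norm_mul`).  THIS FILE: if every `σ`-fixed `a` with `|a − 1| < |c|` is a norm `z·σz` (`hnorm`, some `0 < |c| ≤ 1`),
then for such a `g₀` the OPEN set `V = {g ∈ GL₂(K) | ∃ x, |B₀(x, (g − 1)x) − t| < |c·t|}` (`n(t)` the normal form of `g₀`) contains the whole `U`-class of `g₀`, and every
non-trivial unipotent `g ∈ U ∩ V` is `U`-conjugate to `g₀` — the class `[g₀]` is cut out by an open set inside the stratum `{(g − 1)² = 0} ∖ {1}`.  Proof = ★ FILE A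
(`exists_isOpen_transvection_class_of_norm_lt`, `N = 3`) word for word at `N = 2`: the invariant `B₀(x, (k n(t) k⁻¹ − 1)x) = t·σa·a` (★ `B₀_apply_conj_lineUnipotent_sub_one_mulVec`),
its value set `t·N(K)` (★ `range_B₀_conj_lineUnipotent_sub_one_mulVec`), and the norm class `t⁻¹·t′·N(a) ∈ N(K^×)` forced by `hnorm` when `|t′N(a) − t| < |c t|`.
The radius serves the WILD places (only deep `σ`-fixed units are norms); at radius `4` the hypothesis is the tree's ★ (W-b) `exists_fixed_norm_eq_of_valued_sub_one_lt_four`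
over (W-a) ★ `exists_mul_self_eq_of_valued_sub_one_lt_four_adicCompletion` — EVERY residue characteristic, EVERY ramification (the sequel instantiates).

* §1 `continuous_B₀_two_sub_one_mulVec`, `isOpen_setOf_exists_v_B₀_two_sub_lt_v`, `isClosed_setOf_coe_two_sub_one_pow_eq_zero` (point-set lemmas on `GL₂(K)`);
* §2 **`exists_isOpen_lineUnipotent_class_of_norm_lt`** (radius `|c|`), **`exists_isOpen_lineUnipotent_class_of_norm`** (`c = 1`).

## References
* [Rogawski1990] J. D. Rogawski, *Automorphic Representations of Unitary Groups in Three Variables*, Ann. of Math. Stud. 123 (1990), §1.10 p. 9 (`n(t)`), §3.9 p. 32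
  («the conjugacy class of `n(t)` is determined by `t mod NE^*`»), Prop. 3.9.1.
* [Serre1979] J.-P. Serre, *Local Fields*, GTM 67 (1979), Ch. V §2 Prop. 3, Ch. V §3 (norm groups of quadratic extensions; conductor).
* [BernsteinZelevinsky1976] I. N. Bernstein, A. V. Zelevinsky, *Representations of the group GL(n, F) where F is a non-archimedean local field*, Russian Math. Surveys 31
  (1976), §1.5 (l-spaces, locally closed strata).
* [PlatonovRapinchuk1994] V. Platonov, A. Rapinchuk, *Algebraic Groups and Number Theory* (1994), §3.1 (the topology of `G(K_v)`).
-/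

set_option autoImplicit false

noncomputable section

open scoped Valued WithZero Matrix MatrixGroups
open Topology Set Matrix

namespace Literature.NumberTheory.Automorphic.UnitaryGroup

open Literature.NumberTheory.Automorphic Literature.NumberTheory.Automorphic.HermitianLattice

section MatrixSide

variable {K : Type*} [Field K] [Valued K ℤᵐ⁰] (σ : K →+* K)

/-! ## §1 Point-set lemmas on `GL₂(K)` -/

/-- `g ↦ B₀(x, (g − 1)x)` is continuous on `GL₂(K)` (`x` fixed; `σ` acts on `x` only, so no continuity of `σ` is needed). [cite: PlatonovRapinchuk1994, §3.1] -/
theorem continuous_B₀_two_sub_one_mulVec (x : Fin 2 → K) :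
    Continuous fun g : GL (Fin 2) K => B₀ σ 2 x (((g : Matrix (Fin 2) (Fin 2) K) - 1) *ᵥ x) := by
  have hy : Continuous fun g : GL (Fin 2) K => ((g : Matrix (Fin 2) (Fin 2) K) - 1) *ᵥ x :=
    (Units.continuous_val.sub continuous_const).matrix_mulVec continuous_const
  have h2 : ∀ i : Fin 2, Continuous fun g : GL (Fin 2) K => (((g : Matrix (Fin 2) (Fin 2) K) - 1) *ᵥ x) i :=
    fun i => (continuous_apply i).comp hy
  simp only [B₀_two_apply]
  exact ((continuous_const.mul (h2 1)).add (continuous_const.mul (h2 0)))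

/-- The set of `g ∈ GL₂(K)` for which SOME value `B₀(x, (g − 1)x)` lies in the ball `{c′ : |c′ − t| < |d|}` is open. [cite: PlatonovRapinchuk1994, §3.1] -/
theorem isOpen_setOf_exists_v_B₀_two_sub_lt_v (t d : K) :
    IsOpen {g : GL (Fin 2) K | ∃ x : Fin 2 → K, Valued.v (B₀ σ 2 x (((g : Matrix (Fin 2) (Fin 2) K) - 1) *ᵥ x) - t) < Valued.v d} := by
  have hball : IsOpen {c : K | Valued.v (c - t) < Valued.v d} := by
    have h1 : IsOpen {y : K | Valued.v y < Valued.v d} := by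
      simpa only [Valuation.restrict_lt_iff] using Valued.isOpen_ball K (Valued.v.restrict d)
    exact h1.preimage (continuous_id.sub continuous_const)
  have : {g : GL (Fin 2) K | ∃ x : Fin 2 → K, Valued.v (B₀ σ 2 x (((g : Matrix (Fin 2) (Fin 2) K) - 1) *ᵥ x) - t) < Valued.v d} =
      ⋃ x : Fin 2 → K, (fun g : GL (Fin 2) K => B₀ σ 2 x (((g : Matrix (Fin 2) (Fin 2) K) - 1) *ᵥ x)) ⁻¹' {c : K | Valued.v (c - t) < Valued.v d} := by
    ext g; simp
  rw [this]
  exact isOpen_iUnion fun x => hball.preimage (continuous_B₀_two_sub_one_mulVec σ x)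

omit σ in
/-- `{g ∈ GL₂(K) | (g − 1)^k = 0}` is closed (`K` Hausdorff). [cite: PlatonovRapinchuk1994, §3.1] -/
theorem isClosed_setOf_coe_two_sub_one_pow_eq_zero (k : ℕ) :
    IsClosed {g : GL (Fin 2) K | ((g : Matrix (Fin 2) (Fin 2) K) - 1) ^ k = 0} :=
  isClosed_eq ((Units.continuous_val.sub continuous_const).pow k) continuous_const

/-! ## §2 The class of a non-trivial unipotent element of `U(σ, J₀)` is open in its stratum -/

/-- **THE CLASS `[n(t)]` IS CUT OUT BY AN OPEN SET INSIDE THE STRATUM `{(g − 1)² = 0} ∖ {1}` — norm hypothesis WITH A RADIUS, any residue characteristic** ([Rogawski1990] §3.9: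
the non-trivial unipotent classes of `U(σ, J₀) = U(Φ₂)` are the `[n(t)]`, `t ∈ E⁰ ∖ 0` modulo `N E^×`; the norm class of the invariant `B₀(x, (g − 1)x) ∈ t·N(K)` is LOCALLY CONSTANT as
soon as every `σ`-fixed `a` with `|a − 1| < |c|` is a norm, `hnorm`, for some `0 < |c| ≤ 1`): for `g₀ ∈ U(σ, J₀)` with `(g₀ − 1)² = 0`, `g₀ ≠ 1`, there is an OPEN `V ⊆ GL₂(K)`
(namely `{g | ∃ x, |B₀(x, (g−1)x) − t| < |c·t|}`, `n(t)` the normal form of `g₀`) containing the `U(σ, J₀)`-class of `g₀` such that every `g ∈ U(σ, J₀) ∩ V` with `(g − 1)² = 0`,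
`g ≠ 1` is `U(σ, J₀)`-conjugate to `g₀`.  (Rank-one twin of ★ `exists_isOpen_transvection_class_of_norm_lt`.) [cite: Rogawski1990, §3.9 p. 32, Prop. 3.9.1; §1.10 p. 9]
[cite: Serre1979, Ch. V §2 Prop. 3; Ch. V §3] [cite: BernsteinZelevinsky1976, §1.5] -/
theorem exists_isOpen_lineUnipotent_class_of_norm_lt (hσ : ∀ z : K, σ (σ z) = z) {c : K} (hc : c ≠ 0) (hc1 : Valued.v c ≤ 1)
    (hnorm : ∀ a : K, σ a = a → Valued.v (a - 1) < Valued.v c → ∃ z : K, z ≠ 0 ∧ a = z * σ z)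
    {g₀ : GL (Fin 2) K} (hg₀ : g₀ ∈ unitaryGroupOfForm σ ((StdForm.antidiagonal 2).over K))
    (hsq₀ : ((g₀ : Matrix (Fin 2) (Fin 2) K) - 1) * ((g₀ : Matrix (Fin 2) (Fin 2) K) - 1) = 0) (hne₀ : g₀ ≠ 1) :
    ∃ V : Set (GL (Fin 2) K), IsOpen V ∧
      (∀ k ∈ unitaryGroupOfForm σ ((StdForm.antidiagonal 2).over K), k * g₀ * k⁻¹ ∈ V) ∧
      ∀ g ∈ unitaryGroupOfForm σ ((StdForm.antidiagonal 2).over K),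
        ((g : Matrix (Fin 2) (Fin 2) K) - 1) * ((g : Matrix (Fin 2) (Fin 2) K) - 1) = 0 → g ≠ 1 → g ∈ V →
        ∃ k ∈ unitaryGroupOfForm σ ((StdForm.antidiagonal 2).over K), k * g₀ * k⁻¹ = g := by
  -- normal form `k₀ g₀ k₀⁻¹ = n(t)`, `t ≠ 0`
  obtain ⟨k₀, hk₀, t, hσt, hu⟩ := exists_conj_coe_eq_lineUnipotent σ hσ hg₀ ⟨2, by rw [pow_two]; exact hsq₀⟩
  have ht : t ≠ 0 := by
    intro ht0
    apply hne₀
    have h1 : k₀ * g₀ * k₀⁻¹ = 1 := Units.ext (by rw [hu, ht0, Units.val_one]; ext i j; fin_cases i <;> fin_cases j <;> rfl)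
    calc g₀ = k₀⁻¹ * (k₀ * g₀ * k₀⁻¹) * k₀ := by group
      _ = 1 := by rw [h1]; group
  have htv : Valued.v t ≠ 0 := (Valuation.ne_zero_iff _).2 ht
  refine ⟨{g : GL (Fin 2) K | ∃ x : Fin 2 → K, Valued.v (B₀ σ 2 x (((g : Matrix (Fin 2) (Fin 2) K) - 1) *ᵥ x) - t) < Valued.v (c * t)},
    isOpen_setOf_exists_v_B₀_two_sub_lt_v σ t (c * t), ?_, ?_⟩
  · -- the class of `g₀` lies in `V`: `k g₀ k⁻¹ = k₁ n(t) k₁⁻¹` takes the value `t` at some `x`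
    intro k hk
    have hk₁ : k * k₀⁻¹ ∈ unitaryGroupOfForm σ ((StdForm.antidiagonal 2).over K) := mul_mem hk (inv_mem hk₀)
    have hconj : k * g₀ * k⁻¹ = (k * k₀⁻¹) * (k₀ * g₀ * k₀⁻¹) * (k * k₀⁻¹)⁻¹ := by group
    have hmem : t * (σ 1 * 1) ∈ Set.range (fun x : Fin 2 → K => B₀ σ 2 x (((((k * k₀⁻¹) * (k₀ * g₀ * k₀⁻¹) * (k * k₀⁻¹)⁻¹ : GL (Fin 2) K) : Matrix (Fin 2) (Fin 2) K) - 1) *ᵥ x)) := by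
      rw [range_B₀_conj_lineUnipotent_sub_one_mulVec σ hu hk₁]; exact ⟨1, rfl⟩
    obtain ⟨x, hx⟩ := hmem
    beta_reduce at hx
    refine ⟨x, ?_⟩
    rw [hconj]
    have hx' : B₀ σ 2 x (((((k * k₀⁻¹) * (k₀ * g₀ * k₀⁻¹) * (k * k₀⁻¹)⁻¹ : GL (Fin 2) K) : Matrix (Fin 2) (Fin 2) K) - 1) *ᵥ x) = t := by
      rw [hx, map_one, one_mul, mul_one]
    rw [hx', sub_self, map_zero]
    exact (Valuation.pos_iff _).2 (mul_ne_zero hc ht)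
  · -- a non-trivial unipotent element of `U(σ, J₀)` in `V` is conjugate to `g₀`
    intro g hg hsq hne ⟨x, hx⟩
    obtain ⟨k₂, hk₂, t', hσt', hu'⟩ := exists_conj_coe_eq_lineUnipotent σ hσ hg ⟨2, by rw [pow_two]; exact hsq⟩
    have ht' : t' ≠ 0 := by
      intro ht0
      apply hne
      have h1 : k₂ * g * k₂⁻¹ = 1 := Units.ext (by rw [hu', ht0, Units.val_one]; ext i j; fin_cases i <;> fin_cases j <;> rfl)
      calc g = k₂⁻¹ * (k₂ * g * k₂⁻¹) * k₂ := by group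
        _ = 1 := by rw [h1]; group
    -- the value at `x` reads `t'·N(a)`
    have hgconj : g = k₂⁻¹ * (k₂ * g * k₂⁻¹) * (k₂⁻¹)⁻¹ := by group
    set a : K := (((k₂⁻¹)⁻¹ : GL (Fin 2) K) : Matrix (Fin 2) (Fin 2) K).mulVec x 1 with ha_def
    have hval : B₀ σ 2 x (((g : Matrix (Fin 2) (Fin 2) K) - 1) *ᵥ x) = t' * (σ a * a) := by
      conv_lhs => rw [hgconj]
      exact B₀_apply_conj_lineUnipotent_sub_one_mulVec σ hu' (inv_mem hk₂) x
    rw [hval] at hx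
    have hct : Valued.v (c * t) ≤ Valued.v t := by
      rw [Valuation.map_mul]
      calc Valued.v c * Valued.v t ≤ 1 * Valued.v t := mul_le_mul' hc1 le_rfl
        _ = Valued.v t := one_mul _
    have ha0 : a ≠ 0 := by
      intro h0
      rw [h0, mul_zero, mul_zero, zero_sub, Valuation.map_neg] at hx
      exact lt_irrefl _ (lt_of_lt_of_le hx hct)
    -- the quotient `t⁻¹ t' N(a)` is `σ`-fixed with `|· − 1| < |c|`, hence a norm (by `hnorm`)
    have hσa' : σ (t⁻¹ * (t' * (σ a * a))) = t⁻¹ * (t' * (σ a * a)) := by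
      have hσt1 : σ t = -t := by linear_combination hσt
      have hσt2 : σ t' = -t' := by linear_combination hσt'
      rw [map_mul, map_mul, map_mul, map_inv₀, hσt1, hσt2, hσ, inv_neg]; ring
    have hlt : Valued.v (t⁻¹ * (t' * (σ a * a)) - 1) < Valued.v c := by
      have h : t⁻¹ * (t' * (σ a * a)) - 1 = t⁻¹ * (t' * (σ a * a) - t) := by field_simp
      rw [h, Valuation.map_mul, map_inv₀]
      rw [Valuation.map_mul] at hx
      calc (Valued.v t)⁻¹ * Valued.v (t' * (σ a * a) - t) < (Valued.v t)⁻¹ * (Valued.v c * Valued.v t) := by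
            exact mul_lt_mul_of_pos_left hx (inv_pos.2 (zero_lt_iff.2 htv))
        _ = Valued.v c := by rw [mul_comm (Valued.v c), ← mul_assoc, inv_mul_cancel₀ htv, one_mul]
    obtain ⟨z, hz, hzn⟩ := hnorm _ hσa' hlt
    -- `t' = z′·σz′·t` with `z′ = z ∕ a`
    have hσa0 : σ a ≠ 0 := (map_ne_zero σ).2 ha0
    have htt' : t' = (z * a⁻¹) * σ (z * a⁻¹) * t := by
      rw [map_mul, map_inv₀]
      field_simp
      have h := hzn
      field_simp at h
      linear_combination h
    obtain ⟨k₃, hk₃, hk₃u⟩ := (exists_conj_lineUnipotent_eq_iff_exists_norm_mul σ hσ ht hu hu').2 ⟨z * a⁻¹, mul_ne_zero hz (inv_ne_zero ha0), htt'⟩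
    refine ⟨k₂⁻¹ * k₃ * k₀, mul_mem (mul_mem (inv_mem hk₂) hk₃) hk₀, ?_⟩
    calc k₂⁻¹ * k₃ * k₀ * g₀ * (k₂⁻¹ * k₃ * k₀)⁻¹ = k₂⁻¹ * (k₃ * (k₀ * g₀ * k₀⁻¹) * k₃⁻¹) * k₂ := by group
      _ = k₂⁻¹ * (k₂ * g * k₂⁻¹) * k₂ := by rw [hk₃u]
      _ = g := by group

/-- **THE CLASS `[n(t)]` IS CUT OUT BY AN OPEN SET INSIDE ITS STRATUM — norm-hypothesis form** (radius `1` of `exists_isOpen_lineUnipotent_class_of_norm_lt`): if every `σ`-fixed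
principal unit is a norm (`hnorm`), then for `g₀ ∈ U(σ, J₀)` with `(g₀ − 1)² = 0`, `g₀ ≠ 1` there is an OPEN `V ⊆ GL₂(K)` containing the `U(σ, J₀)`-class of `g₀` such that every
`g ∈ U(σ, J₀) ∩ V` with `(g − 1)² = 0`, `g ≠ 1` is `U(σ, J₀)`-conjugate to `g₀`. [cite: Rogawski1990, §3.9 p. 32, Prop. 3.9.1] [cite: Serre1979, Ch. V §2 Prop. 3]
[cite: BernsteinZelevinsky1976, §1.5] -/
theorem exists_isOpen_lineUnipotent_class_of_norm (hσ : ∀ z : K, σ (σ z) = z)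
    (hnorm : ∀ a : K, σ a = a → Valued.v (a - 1) < 1 → ∃ z : K, z ≠ 0 ∧ a = z * σ z)
    {g₀ : GL (Fin 2) K} (hg₀ : g₀ ∈ unitaryGroupOfForm σ ((StdForm.antidiagonal 2).over K))
    (hsq₀ : ((g₀ : Matrix (Fin 2) (Fin 2) K) - 1) * ((g₀ : Matrix (Fin 2) (Fin 2) K) - 1) = 0) (hne₀ : g₀ ≠ 1) :
    ∃ V : Set (GL (Fin 2) K), IsOpen V ∧
      (∀ k ∈ unitaryGroupOfForm σ ((StdForm.antidiagonal 2).over K), k * g₀ * k⁻¹ ∈ V) ∧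
      ∀ g ∈ unitaryGroupOfForm σ ((StdForm.antidiagonal 2).over K),
        ((g : Matrix (Fin 2) (Fin 2) K) - 1) * ((g : Matrix (Fin 2) (Fin 2) K) - 1) = 0 → g ≠ 1 → g ∈ V →
        ∃ k ∈ unitaryGroupOfForm σ ((StdForm.antidiagonal 2).over K), k * g₀ * k⁻¹ = g :=
  exists_isOpen_lineUnipotent_class_of_norm_lt σ hσ one_ne_zero (le_of_eq (Valuation.map_one _))
    (fun a hfix ha => hnorm a hfix (by rw [Valuation.map_one] at ha; exact ha)) hg₀ hsq₀ hne₀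

end MatrixSide

end Literature.NumberTheory.Automorphic.UnitaryGroup

end
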